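import Summits.CriticalPhenomena.CardyFormulaZ2.Theorems.CardyBoundaryCoulombGasHalfPlaneMarkDensityLawSelfDualityExact
import Summits.CriticalPhenomena.CardyFormulaZ2.Theorems.CardyBoundaryCoulombGasHalfPlaneMarkDensityLawEquicontinuity
import Literature.Probability.Percolation.Z2HalfPlaneThreeArm

/-!
# Joint subsequential limits tend to `1` as the gap closes: the probability step G5 from G4
# (crux `HalfPlaneMarkDensityLaw`, stmt-CriticalPhenomena-5661, line `Sketch`, cycle-2 skeleton
# `Lines/Sketch_GapClose.lean`, stub `stub_one_sub_crossing_le_of`)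

`μ = P_{1/2}` is critical bond percolation on `ℤ²`, `H = ℤ × ℕ` the lattice half-plane,
`rowIcc i j = [i,j]×{0}`.  The glue theorem of this file turns the deterministic statement G4
("not joining `[α',−S]×{0}` to `[1,X]×{0}` inside `H` forces one closed arm of `ω` from the moat under
the gap window `[−S, 1)` to sup-distance `R`, i.e. `ω ∈ Z2HalfPlane.oneArm (−S) (S+1) R`, whenever
the set of sites joined to the target arc is bounded") into the probability bound G5:
`1 − C₁ ((γ−β)/R)^α ≤ P_{1/2}[[α',β]×{0} ↔ [γ,δ]×{0} in H]` for
`K₁ (γ−β) ≤ R ≤ min (δ−γ+1) (β−α'+1)`, with the constants `C₁, α, K₁` of the tree's one-arm bound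
`Z2HalfPlane.real_oneArm_le`.

* Step A (fixed position `γ = 1`): the complement of the crossing event is a.s. contained in the
  one-arm event (G4 on the full-measure set of `SelfDual.ae_bounded_joined`, Harris' theorem), so
  `1 − P(E) = P(Eᶜ) ≤ P(oneArm (−S) (S+1) R) ≤ C₁ ((S+1)/R)^α`.
* Step B: the exact lattice translation `Subseq.crossing_shift` by `s = γ − 1` reduces general
  positions `α' ≤ β < γ ≤ δ` to Step A with `S = γ − 1 − β`, `X = δ − γ + 1`.

Sources: G. F. Lawler, O. Schramm, W. Werner, Electron. J. Probab. 7 (2002), Appendix A (one-arm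
bound in the half-plane); G. Grimmett, *Percolation* (1999), §11.2 (planar duality at `p = 1/2`).
No named unproved facts are used.
-/

noncomputable section

namespace Summit.CriticalPhenomena.CardyFormulaZ2.Cruxes.HalfPlaneMarkDensityLaw.SketchLine

open Literature.Probability.Percolation Literature.Probability.LatticeModels
open Literature.Probability.Percolation.Z2HalfPlane (leg Far faceBox oneArm)
open MeasureTheory Filter Set SimpleGraph
open scoped Topology
open Summit.CriticalPhenomena.CardyFormulaZ2.Theorems.HalfPlaneMarkDensityLaw.Negative

namespace GapClose

/-- **Step A at fixed position** (`γ = 1`): if not joining `[α',−S]×{0}` to `[1,X]×{0}` inside `H`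
forces (for configurations with bounded joined set) one arm of `oneArm (−S) (S+1) R`, then
`1 − C₁ ((S+1)/R)^α ≤ P_{1/2}[[α',−S]×{0} ↔ [1,X]×{0} in H]` whenever `P(oneArm (−S) (S+1) R)` obeys the
one-arm bound with constants `C₁, α`. [folklore] -/
theorem one_sub_le_crossing_fixed
    (hG4 : ∀ (ω : BondConfig (Site 2)) (α' S X : ℤ) (R N : ℕ), α' ≤ -S → 0 ≤ S → 1 ≤ X →
      (∀ y : Site 2, (∃ r ∈ rowIcc 1 X, ω ∈ openConnIn halfPlane r y) → |y 0| ≤ N ∧ y 1 ≤ N) →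
      ω ∉ openCrossing halfPlane (rowIcc α' (-S)) (rowIcc 1 X) → (R : ℤ) ≤ X → (R : ℤ) ≤ -S - α' + 1 →
      ω ∈ oneArm (-S) (S.toNat + 1) R)
    {C₁ α : ℝ} {α' S X : ℤ} {R : ℕ} (hα' : α' ≤ -S) (hS : 0 ≤ S) (hX : 1 ≤ X) (hRX : (R : ℤ) ≤ X)
    (hRα : (R : ℤ) ≤ -S - α' + 1)
    (harm : μ.real (oneArm (-S) (S.toNat + 1) R) ≤ C₁ * (((S : ℝ) + 1) / R) ^ α) :
    1 - C₁ * (((S : ℝ) + 1) / R) ^ α ≤ μ.real (openCrossing halfPlane (rowIcc α' (-S)) (rowIcc 1 X)) := by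
  set E : Set (BondConfig (Site 2)) := openCrossing halfPlane (rowIcc α' (-S)) (rowIcc 1 X) with hEdef
  have hEm : MeasurableSet E := measurableSet_openCrossing_of_countable _ _ _
  -- a.s., not crossing forces one arm from the moat under the gap window
  have hincl : ∀ᵐ ω ∂μ, ω ∈ Eᶜ → ω ∈ oneArm (-S) (S.toNat + 1) R := by
    filter_upwards [SelfDual.ae_bounded_joined X] with ω ⟨N, hN⟩ hωE
    exact hG4 ω α' S X R N hα' hS hX hN hωE hRX hRα
  have h1 : μ.real Eᶜ ≤ μ.real (oneArm (-S) (S.toNat + 1) R) := by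
    rw [measureReal_def, measureReal_def]
    exact ENNReal.toReal_mono (measure_ne_top _ _) (measure_mono_ae hincl)
  have h2 : μ.real Eᶜ = 1 - μ.real E := by
    rw [measureReal_compl hEm, probReal_univ]
  linarith

/-- STUB G5' (glue): G4 (with `SelfDual.ae_bounded_joined`, `Z2HalfPlane.real_oneArm_le`, `crossing_shift`) gives G5. [folklore] -/
theorem stub_one_sub_crossing_le_of :
    (∀ (ω : BondConfig (Site 2)) (α' S X : ℤ) (R N : ℕ), α' ≤ -S → 0 ≤ S → 1 ≤ X → (∀ y : Site 2, (∃ r ∈ rowIcc 1 X, ω ∈ openConnIn halfPlane r y) → |y 0| ≤ N ∧ y 1 ≤ N) → ω ∉ openCrossing halfPlane (rowIcc α' (-S)) (rowIcc 1 X) → (R : ℤ) ≤ X → (R : ℤ) ≤ -S - α' + 1 → ω ∈ oneArm (-S) (S.toNat + 1) R) →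
    ∃ C₁ α : ℝ, 0 < C₁ ∧ 0 < α ∧ ∃ K₁ : ℕ, 1 ≤ K₁ ∧ ∀ (α' β γ δ : ℤ) (R : ℕ), α' ≤ β → β < γ → γ ≤ δ → (K₁ : ℤ) * (γ - β) ≤ R → (R : ℤ) ≤ δ - γ + 1 → (R : ℤ) ≤ β - α' + 1 → 1 - C₁ * (((γ : ℝ) - β) / R) ^ α ≤ μ.real (openCrossing halfPlane (rowIcc α' β) (rowIcc γ δ)) := by
  intro hG4
  obtain ⟨C₁, α, hC₁, hα, K₁, hK₁, harm⟩ := Z2HalfPlane.real_oneArm_le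
  refine ⟨C₁, α, hC₁, hα, K₁, hK₁, ?_⟩
  intro α' β γ δ R hαβ hβγ hγδ hKR hRδ hRβ
  -- Step B: translate by `s = γ - 1` to the fixed position `γ = 1`
  have key := Subseq.crossing_shift (γ - 1) (α' - (γ - 1)) (-(γ - 1 - β)) 1 (δ - γ + 1)
  rw [show α' - (γ - 1) + (γ - 1) = α' by ring, show -(γ - 1 - β) + (γ - 1) = β by ring,
    show (1 : ℤ) + (γ - 1) = γ by ring, show δ - γ + 1 + (γ - 1) = δ by ring] at key
  rw [key]
  -- the one-arm bound for the window `[-S, 1)` of `S + 1` sites, `S = γ - 1 - β`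
  have hm : (((γ - 1 - β).toNat + 1 : ℕ) : ℤ) = γ - β := by omega
  have hKR' : K₁ * ((γ - 1 - β).toNat + 1) ≤ R := by
    have h : (K₁ : ℤ) * (((γ - 1 - β).toNat + 1 : ℕ) : ℤ) ≤ R := by rw [hm]; exact hKR
    exact_mod_cast h
  have h3 := harm (-(γ - 1 - β)) ((γ - 1 - β).toNat + 1) R (Nat.succ_le_succ (Nat.zero_le _)) hKR'
  have hmR : (((γ - 1 - β).toNat + 1 : ℕ) : ℝ) = ((γ - 1 - β : ℤ) : ℝ) + 1 := by
    have h : ((((γ - 1 - β).toNat + 1 : ℕ) : ℤ) : ℝ) = ((γ - β : ℤ) : ℝ) := by rw [hm]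
    push_cast at h ⊢
    linarith
  rw [hmR] at h3
  have hA := one_sub_le_crossing_fixed hG4 (C₁ := C₁) (α := α) (α' := α' - (γ - 1)) (S := γ - 1 - β)
    (X := δ - γ + 1) (R := R) (by omega) (by omega) (by omega) (by omega) (by omega) h3
  have hcast : ((γ - 1 - β : ℤ) : ℝ) + 1 = (γ : ℝ) - β := by push_cast; ring
  rw [hcast] at hA
  exact hA

end GapClose

end Summit.CriticalPhenomena.CardyFormulaZ2.Cruxes.HalfPlaneMarkDensityLaw.SketchLine

end
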